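import Summits.KontsevichZagierPeriods.KontsevichZagierPeriods.Theorems.HeckeMultiplicityOneManinStokesTileInverse

/-!
# `ManinStokes` (stmt-KontsevichZagierPeriods-5277): `re G`, `im G` are `ℚ`-semialgebraic on the punctured
# closed lower half plane

Support file (prover-owned, `--supports stmt-KontsevichZagierPeriods-5277`). For `f ∈ S₂(Γ₀(N))` with
rational Fourier coefficients, `h ∈ SL₂(ℤ)` and a right inverse `ψ` of `j` on `{im u ≤ 0}`, the integrand
`G = (ω/dj)(f ∣ h) ∘ ψ` of the per-tile Cauchy relation satisfies a PRIMITIVE rational relation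
`P₁(u, G u) = 0` off `{0, 1728}` (`exists_isPrimitive_evalC_djQuot_tileInv_eq_zero`: the Sturm-count relation
`exists_rat_relation_djQuot` of the tree, transported by `djQuot_SL_slash`, divided by the content, extended
over the content's zeros by continuity and density), and **`re G`, `im G` are `ℚ`-semialgebraic functions
of `(re u, im u)`** there (`isSemialgebraicFunOn_reIm_djQuot_tileInv`): the two-variable case of the
selection lemma `isSemialgebraicFunOn_of_continuousOn_of_finite_fibres` (cylindrical decomposition over `ℚ`)
applied to the Tarski–Seidenberg projections of `{(re u, im u, a, b) | P₁(u, a + ib) = 0} ⊆ ℝ⁴`, whose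
real/imaginary parts are `ℚ`-polynomials in four variables (`exists_reIm_parts4`).

References: G. Shimura, *Introduction to the arithmetic theory of automorphic functions* (1971), §6.2;
S. Basu, R. Pollack, M.-F. Roy, *Algorithms in Real Algebraic Geometry* (2006), Thm. 2.76, Thm. 5.6,
Cor. 5.7. No definitions, no named facts.
-/

noncomputable section

open scoped MatrixGroups ModularForm Modular Manifold Topology Polynomial Polynomial.Bivariate
open CongruenceSubgroup Complex Set Filter MeasureTheory ModularForm
open UpperHalfPlane hiding I
open Literature.ModelTheory.ExponentialFields
open Literature.NumberTheory.Transcendental (IsSemialgebraicFunOn isSemialgebraicFunOn_iff)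
open Literature.NumberTheory.EllipticCurves Literature.NumberTheory.EllipticCurves.ModularForms

namespace Summit.KontsevichZagierPeriods.HeckeMultiplicityOne.ManinStokes

/-! ### Real and imaginary parts of `P(u, w)` for COMPLEX `u`: polynomials over `ℚ` in four real variables -/

section ReIm4

open MvPolynomial
open Polynomial (eval₂)

/-- The real and imaginary parts of `(x_a + i x_b)^m` are polynomials over `ℚ`. [folklore] -/
theorem exists_reIm_pow_pair (a b : Fin 4) (m : ℕ) : ∃ RI : MvPolynomial (Fin 4) ℚ × MvPolynomial (Fin 4) ℚ,
    ∀ x : Fin 4 → ℝ, ((aeval x RI.1 : ℝ) : ℂ) + ((aeval x RI.2 : ℝ) : ℂ) * Complex.I =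
      ((x a : ℂ) + (x b : ℂ) * Complex.I) ^ m := by
  induction m with
  | zero => exact ⟨(1, 0), fun x => by simp⟩
  | succ m ih =>
    obtain ⟨RI, hRI⟩ := ih
    refine ⟨(X a * RI.1 - X b * RI.2, X a * RI.2 + X b * RI.1), fun x => ?_⟩
    simp only [map_sub, map_mul, map_add, aeval_X, pow_succ, ← hRI x]
    push_cast
    ring_nf
    rw [Complex.I_sq]
    ring

/-- The real and imaginary parts of `c(x₀ + i x₁)` for `c ∈ ℚ[U]` are polynomials over `ℚ`. [folklore] -/
theorem exists_reIm_aeval (c : ℚ[X]) : ∃ RI : MvPolynomial (Fin 4) ℚ × MvPolynomial (Fin 4) ℚ,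
    ∀ x : Fin 4 → ℝ, ((aeval x RI.1 : ℝ) : ℂ) + ((aeval x RI.2 : ℝ) : ℂ) * Complex.I =
      Polynomial.aeval ((x 0 : ℂ) + (x 1 : ℂ) * Complex.I) c := by
  choose RI hRI using exists_reIm_pow_pair 0 1
  refine ⟨(c.sum fun i r => MvPolynomial.C r * (RI i).1, c.sum fun i r => MvPolynomial.C r * (RI i).2),
    fun x => ?_⟩
  rw [Polynomial.aeval_def, Polynomial.eval₂_eq_sum]
  simp only [Polynomial.sum_def, map_sum, map_mul, MvPolynomial.aeval_C, Complex.ofReal_sum,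
    Complex.ofReal_mul, Finset.sum_mul]
  rw [← Finset.sum_add_distrib]
  refine Finset.sum_congr rfl fun i _ => ?_
  rw [← hRI i x]
  simp only [eq_ratCast, Complex.ofReal_ratCast]
  ring

/-- **`re` and `im` of `Q(x₀ + i x₁, x₂ + i x₃)` are polynomials over `ℚ` in `(x₀, x₁, x₂, x₃)`** for
`Q ∈ ℚ[U][V]`. [folklore] -/
theorem exists_reIm_parts4 (Q : ℚ[X][Y]) : ∃ RI : MvPolynomial (Fin 4) ℚ × MvPolynomial (Fin 4) ℚ,
    ∀ x : Fin 4 → ℝ, ((aeval x RI.1 : ℝ) : ℂ) + ((aeval x RI.2 : ℝ) : ℂ) * Complex.I =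
      eval₂ (Polynomial.aeval (R := ℚ) ((x 0 : ℂ) + (x 1 : ℂ) * Complex.I) : ℚ[X] →+* ℂ)
        ((x 2 : ℂ) + (x 3 : ℂ) * Complex.I) Q := by
  choose RW hRW using exists_reIm_pow_pair 2 3
  choose RC hRC using exists_reIm_aeval
  refine ⟨(Q.sum fun i c => (RC c).1 * (RW i).1 - (RC c).2 * (RW i).2,
    Q.sum fun i c => (RC c).1 * (RW i).2 + (RC c).2 * (RW i).1), fun x => ?_⟩
  simp only [Polynomial.eval₂_eq_sum, Polynomial.sum_def, map_sum, map_mul, map_sub, map_add,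
    Complex.ofReal_sum, Complex.ofReal_mul, Complex.ofReal_sub, Complex.ofReal_add, Finset.sum_mul]
  rw [← Finset.sum_add_distrib]
  refine Finset.sum_congr rfl fun i _ => ?_
  have h1 := hRC (Q.coeff i) x
  have h2 := hRW i x
  have : ((Polynomial.aeval (R := ℚ) ((x 0 : ℂ) + (x 1 : ℂ) * Complex.I) : ℚ[X] →+* ℂ) (Q.coeff i) : ℂ) =
      Polynomial.aeval ((x 0 : ℂ) + (x 1 : ℂ) * Complex.I) (Q.coeff i) := rfl
  rw [this, ← h1, ← h2]
  ring_nf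
  rw [Complex.I_sq]
  ring

/-- **The zero set `{(x₀, x₁, a, b) | Q(x₀ + ix₁, a + ib) = 0} ⊆ ℝ⁴` is `ℚ`-semialgebraic.** [folklore] -/
theorem isSemialgebraic_setOf_evalC4_eq_zero (Q : ℚ[X][Y]) :
    IsSemialgebraic ℚ {x : Fin 4 → ℝ | eval₂ (Polynomial.aeval (R := ℚ) ((x 0 : ℂ) + (x 1 : ℂ) * Complex.I) :
      ℚ[X] →+* ℂ) ((x 2 : ℂ) + (x 3 : ℂ) * Complex.I) Q = 0} := by
  obtain ⟨RI, hRI⟩ := exists_reIm_parts4 Q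
  have h : {x : Fin 4 → ℝ | eval₂ (Polynomial.aeval (R := ℚ) ((x 0 : ℂ) + (x 1 : ℂ) * Complex.I) :
      ℚ[X] →+* ℂ) ((x 2 : ℂ) + (x 3 : ℂ) * Complex.I) Q = 0} =
        {x | aeval x RI.1 = 0} ∩ {x | aeval x RI.2 = 0} := by
    ext x
    rw [mem_setOf_eq, ← hRI x, Complex.ext_iff]
    simp
  rw [h]
  exact (isSemialgebraic_setOf_eval_eq_zero (R := ℝ) RI.1).inter
    (isSemialgebraic_setOf_eval_eq_zero (R := ℝ) RI.2)

/-- The same zero set with the last two coordinates exchanged. [folklore] -/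
theorem isSemialgebraic_setOf_evalC4_eq_zero_swap (Q : ℚ[X][Y]) :
    IsSemialgebraic ℚ {x : Fin 4 → ℝ | eval₂ (Polynomial.aeval (R := ℚ) ((x 0 : ℂ) + (x 1 : ℂ) * Complex.I) :
      ℚ[X] →+* ℂ) ((x 3 : ℂ) + (x 2 : ℂ) * Complex.I) Q = 0} := by
  have h := (isSemialgebraic_setOf_evalC4_eq_zero Q).preimage_comp (Equiv.swap (2 : Fin 4) 3)
  convert h using 1
  ext x
  have h0 : (Equiv.swap (2 : Fin 4) 3) 0 = 0 := by decide
  have h1 : (Equiv.swap (2 : Fin 4) 3) 1 = 1 := by decide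
  simp [h0, h1]

/-- **Projection to the real part**: `{(x₀, x₁, a) | ∃ b, Q(x₀ + ix₁, a + ib) = 0} ⊆ ℝ³` is
`ℚ`-semialgebraic (Tarski–Seidenberg). [cite: BasuPollackRoy2006, Thm. 2.76] -/
theorem isSemialgebraic_setOf_exists_evalC4_re (Q : ℚ[X][Y]) :
    IsSemialgebraic ℚ {y : Fin 3 → ℝ | ∃ b : ℝ, eval₂ (Polynomial.aeval (R := ℚ) ((y 0 : ℂ) + (y 1 : ℂ) * Complex.I) :
      ℚ[X] →+* ℂ) ((y 2 : ℂ) + (b : ℂ) * Complex.I) Q = 0} := by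
  have h := tarski_seidenberg_real_holds (k := ℚ) (isSemialgebraic_setOf_evalC4_eq_zero Q)
  convert h using 1
  ext y
  simp only [mem_setOf_eq, mem_image]
  constructor
  · rintro ⟨b, hb⟩
    refine ⟨Fin.snoc y b, ?_, ?_⟩
    · simpa [Fin.snoc] using hb
    · ext i; simp [Fin.snoc_castSucc]
  · rintro ⟨x, hx, rfl⟩
    exact ⟨x 3, by simpa using hx⟩

/-- **Projection to the imaginary part**: `{(x₀, x₁, b) | ∃ a, Q(x₀ + ix₁, a + ib) = 0} ⊆ ℝ³` is
`ℚ`-semialgebraic. [cite: BasuPollackRoy2006, Thm. 2.76] -/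
theorem isSemialgebraic_setOf_exists_evalC4_im (Q : ℚ[X][Y]) :
    IsSemialgebraic ℚ {y : Fin 3 → ℝ | ∃ a : ℝ, eval₂ (Polynomial.aeval (R := ℚ) ((y 0 : ℂ) + (y 1 : ℂ) * Complex.I) :
      ℚ[X] →+* ℂ) ((a : ℂ) + (y 2 : ℂ) * Complex.I) Q = 0} := by
  have h := tarski_seidenberg_real_holds (k := ℚ) (isSemialgebraic_setOf_evalC4_eq_zero_swap Q)
  convert h using 1
  ext y
  simp only [mem_setOf_eq, mem_image]
  constructor
  · rintro ⟨a, ha⟩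
    refine ⟨Fin.snoc y a, ?_, ?_⟩
    · simpa [Fin.snoc] using ha
    · ext i; simp [Fin.snoc_castSucc]
  · rintro ⟨x, hx, rfl⟩
    exact ⟨x 3, by simpa using hx⟩

end ReIm4

/-! ### The rational relation on the closed lower half plane and semialgebraicity of `re G`, `im G` -/

section Semialgebraic

open Polynomial (eval₂)

variable {N : ℕ} [NeZero N]

/-- **`G = (ω/dj) ∘ ψ` satisfies a primitive rational relation on the punctured closed lower half
plane**: for `f ∈ S₂(Γ₀(N))` with rational coefficients and `h ∈ SL₂(ℤ)` there is a primitive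
`P₁ ∈ ℚ[U][V]` with `P₁(u, djQuot (f ∣ h) (ψ u)) = 0` for `im u ≤ 0`, `u ∉ {0, 1728}`
(`exists_rat_relation_djQuot` transported by `djQuot_SL_slash` and `j(h ψ u) = j(ψ u) = u`, divided by
the content and extended over its finitely many zeros by continuity and density). [cite: Shimura1971, §6.2 Thm. 6.6 (1)–(2) and Prop. 6.9 (1)] -/
theorem exists_isPrimitive_evalC_djQuot_tileInv_eq_zero {ψ : ℂ → ℍ}
    (hψ : ∀ u : ℂ, u.im ≤ 0 → ψ u ∈ {z : ℍ | z ∈ 𝒟 ∧ 0 ≤ z.re} ∧ kleinJ (ψ u) = u)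
    (f : CuspForm (Gamma0 N) 2) (hf : HasRatCoeffs f) (h : SL(2, ℤ)) :
    ∃ P₁ : ℚ[X][Y], P₁.IsPrimitive ∧ ∀ u : ℂ, u ∈ {u : ℂ | u.im ≤ 0 ∧ u ≠ 0 ∧ u ≠ 1728} →
      eval₂ (Polynomial.aeval (R := ℚ) u : ℚ[X] →+* ℂ) (djQuot (⇑f ∣[(2 : ℤ)] h) (ψ u)) P₁ = 0 := by
  classical
  obtain ⟨P, hP0, hP⟩ := exists_rat_relation_djQuot f hf
  refine ⟨P.primPart, P.isPrimitive_primPart, ?_⟩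
  have hc0 : P.content ≠ 0 := by rwa [Ne, Polynomial.content_eq_zero_iff]
  set D := {u : ℂ | u.im ≤ 0 ∧ u ≠ 0 ∧ u ≠ 1728} with hD
  set w : ℂ → ℂ := fun u => djQuot (⇑f ∣[(2 : ℤ)] h) (ψ u) with hw
  -- the relation for `P` on `D`
  have hPw : ∀ u ∈ D, eval₂ (Polynomial.aeval (R := ℚ) u : ℚ[X] →+* ℂ) (w u) P = 0 := by
    rintro u ⟨hu, h0, h1⟩
    have hj : kleinJ (h • ψ u) = u := by rw [kleinJ_smul, (hψ u hu).2]
    have h4 : E₄ (h • ψ u) ≠ 0 := by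
      rw [levelOne_apply_smul]
      exact mul_ne_zero (zpow_ne_zero _ (denom_ne_zero _ _)) (E₄_tileInv_ne_zero hψ hu h0)
    have h6 : E₆ (h • ψ u) ≠ 0 := by
      rw [levelOne_apply_smul]
      exact mul_ne_zero (zpow_ne_zero _ (denom_ne_zero _ _)) (E₆_tileInv_ne_zero hψ hu h1)
    have := hP (h • ψ u) h4 h6
    rwa [hj, ← djQuot_SL_slash] at this
  have hfact : ∀ (u z : ℂ), eval₂ (Polynomial.aeval (R := ℚ) u : ℚ[X] →+* ℂ) z P =
      Polynomial.aeval u P.content * eval₂ (Polynomial.aeval (R := ℚ) u : ℚ[X] →+* ℂ) z P.primPart := by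
    intro u z
    conv_lhs => rw [P.eq_C_content_mul_primPart]
    rw [Polynomial.eval₂_mul, Polynomial.eval₂_C]
    rfl
  -- the complex zeros of the content are finite
  have hZfin : {u : ℂ | Polynomial.aeval u P.content = 0}.Finite := by
    have hne : P.content.map (algebraMap ℚ ℂ) ≠ 0 := by
      rwa [Ne, Polynomial.map_eq_zero_iff (algebraMap ℚ ℂ).injective]
    refine (Polynomial.finite_setOf_isRoot hne).subset fun u hu => ?_
    rw [mem_setOf_eq] at hu
    rwa [mem_setOf_eq, Polynomial.IsRoot.def, Polynomial.eval_map, ← Polynomial.aeval_def]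
  -- continuity of `u ↦ P₁(u, w u)` on `D`
  have hcontw : ContinuousOn w D := continuousOn_djQuot_tileInv hψ (isCuspFunction_slash f h).mdifferentiable
  have hcontE : ContinuousOn (fun u : ℂ => eval₂ (Polynomial.aeval (R := ℚ) u : ℚ[X] →+* ℂ) (w u) P.primPart) D := by
    have heq : (fun u : ℂ => eval₂ (Polynomial.aeval (R := ℚ) u : ℚ[X] →+* ℂ) (w u) P.primPart) =
        fun u : ℂ => ∑ i ∈ P.primPart.support, Polynomial.aeval u (P.primPart.coeff i) * w u ^ i := by
      funext u
      rw [Polynomial.eval₂_eq_sum, Polynomial.sum_def]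
      rfl
    rw [heq]
    refine continuousOn_finsetSum _ fun i _ => ContinuousOn.mul ?_ (hcontw.pow i)
    have hc : Continuous fun u : ℂ => Polynomial.aeval u (P.primPart.coeff i) := by
      have : (fun u : ℂ => Polynomial.aeval u (P.primPart.coeff i)) =
          fun u : ℂ => ((P.primPart.coeff i).map (algebraMap ℚ ℂ)).eval u := by
        funext u
        rw [Polynomial.eval_map, Polynomial.aeval_def]
      rw [this]
      exact Polynomial.continuous _
    exact hc.continuousOn
  have hEq : EqOn (fun u : ℂ => eval₂ (Polynomial.aeval (R := ℚ) u : ℚ[X] →+* ℂ) (w u) P.primPart)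
      (fun _ => 0) (D \ {u | Polynomial.aeval u P.content = 0}) := by
    rintro u ⟨hu, hcu⟩
    have h' := hPw u hu
    rw [hfact] at h'
    exact (mul_eq_zero.mp h').resolve_left hcu
  -- `D` lies in the closure of the open lower half plane minus the finite set
  have hcl : D ⊆ closure (D \ {u | Polynomial.aeval u P.content = 0}) := by
    have hd : Dense ({u : ℂ | Polynomial.aeval u P.content = 0}ᶜ) := by
      rw [Set.compl_eq_univ_sdiff]; exact dense_univ.sdiff_finite hZfin
    have hopen : IsOpen {v : ℂ | v.im < 0} := isOpen_lt Complex.continuous_im continuous_const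
    have h1 : {v : ℂ | v.im < 0} ⊆ closure ({v : ℂ | v.im < 0} ∩ {u | Polynomial.aeval u P.content = 0}ᶜ) :=
      hd.open_subset_closure_inter hopen
    have hsub : {v : ℂ | v.im < 0} ∩ {u | Polynomial.aeval u P.content = 0}ᶜ ⊆
        D \ {u | Polynomial.aeval u P.content = 0} := by
      rintro v ⟨hv, hv'⟩
      refine ⟨⟨le_of_lt hv, ?_, ?_⟩, hv'⟩
      · intro h0; rw [h0] at hv; simp at hv
      · intro h1'; rw [h1'] at hv; norm_num at hv
    have h2 : closure {v : ℂ | v.im < 0} ⊆ closure (D \ {u | Polynomial.aeval u P.content = 0}) := by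
      calc closure {v : ℂ | v.im < 0}
          ⊆ closure (closure ({v : ℂ | v.im < 0} ∩ {u | Polynomial.aeval u P.content = 0}ᶜ)) :=
            closure_mono h1
        _ = closure ({v : ℂ | v.im < 0} ∩ {u | Polynomial.aeval u P.content = 0}ᶜ) := closure_closure
        _ ⊆ closure (D \ {u | Polynomial.aeval u P.content = 0}) := closure_mono hsub
    intro u hu
    apply h2
    rw [Complex.closure_setOf_im_lt]
    exact hu.1
  have hall := hEq.of_subset_closure hcontE continuousOn_const Set.sdiff_subset hcl
  intro u hu
  exact hall hu

/-- The vertical fibre of a subset of `ℝ³` over a point of `ℝ²`, unfolded. [folklore] -/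
theorem setOf_snoc2_mem_eq (x : Fin 2 → ℝ) (p : ℝ → ℝ → ℝ → Prop) :
    {t : ℝ | (Fin.snoc x t : Fin 3 → ℝ) ∈ {y : Fin 3 → ℝ | p (y 0) (y 1) (y 2)}} = {t | p (x 0) (x 1) t} := by
  ext t
  simp only [mem_setOf_eq]
  have h0 : (Fin.snoc x t : Fin 3 → ℝ) 0 = x 0 := by
    rw [show (0 : Fin 3) = Fin.castSucc (0 : Fin 2) from rfl, Fin.snoc_castSucc]
  have h1 : (Fin.snoc x t : Fin 3 → ℝ) 1 = x 1 := by
    rw [show (1 : Fin 3) = Fin.castSucc (1 : Fin 2) from rfl, Fin.snoc_castSucc]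
  have h2 : (Fin.snoc x t : Fin 3 → ℝ) 2 = t := by
    rw [show (2 : Fin 3) = Fin.last 2 from rfl, Fin.snoc_last]
  rw [h0, h1, h2]

/-- The punctured closed lower half plane, as a subset of `ℝ²`, is `ℚ`-semialgebraic. [folklore] -/
theorem isSemialgebraic_puncturedLowerHalfPlane :
    IsSemialgebraic ℚ {w : Fin 2 → ℝ | w 1 ≤ 0 ∧ ¬(w 0 = 0 ∧ w 1 = 0) ∧ ¬(w 0 = 1728 ∧ w 1 = 0)} := by
  have h1 : IsSemialgebraic ℚ {w : Fin 2 → ℝ | w 1 ≤ 0} := by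
    have h := isSemialgebraic_setOf_eval_nonneg (k := ℚ) (R := ℝ) (-(MvPolynomial.X (1 : Fin 2)))
    have he : {w : Fin 2 → ℝ | w 1 ≤ 0} = {x : Fin 2 → ℝ | 0 ≤ MvPolynomial.aeval x (-(MvPolynomial.X (1 : Fin 2)) : MvPolynomial (Fin 2) ℚ)} := by
      ext w; simp
    rw [he]; exact h
  have h2 : IsSemialgebraic ℚ {w : Fin 2 → ℝ | ¬(w 0 = 0 ∧ w 1 = 0)} := by
    have h := ((isSemialgebraic_setOf_eval_eq_zero (k := ℚ) (R := ℝ) (MvPolynomial.X (0 : Fin 2))).inter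
      (isSemialgebraic_setOf_eval_eq_zero (k := ℚ) (R := ℝ) (MvPolynomial.X (1 : Fin 2)))).compl
    have he : {w : Fin 2 → ℝ | ¬(w 0 = 0 ∧ w 1 = 0)} =
        ({x : Fin 2 → ℝ | MvPolynomial.aeval x (MvPolynomial.X (0 : Fin 2) : MvPolynomial (Fin 2) ℚ) = 0} ∩
          {x : Fin 2 → ℝ | MvPolynomial.aeval x (MvPolynomial.X (1 : Fin 2) : MvPolynomial (Fin 2) ℚ) = 0})ᶜ := by
      ext w; simp [not_and]
    rw [he]; exact h
  have h3 : IsSemialgebraic ℚ {w : Fin 2 → ℝ | ¬(w 0 = 1728 ∧ w 1 = 0)} := by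
    have h := ((isSemialgebraic_setOf_eval_eq_zero (k := ℚ) (R := ℝ)
      (MvPolynomial.X (0 : Fin 2) - MvPolynomial.C (1728 : ℚ))).inter
      (isSemialgebraic_setOf_eval_eq_zero (k := ℚ) (R := ℝ) (MvPolynomial.X (1 : Fin 2)))).compl
    have he : {w : Fin 2 → ℝ | ¬(w 0 = 1728 ∧ w 1 = 0)} =
        ({x : Fin 2 → ℝ | MvPolynomial.aeval x (MvPolynomial.X (0 : Fin 2) - MvPolynomial.C (1728 : ℚ) : MvPolynomial (Fin 2) ℚ) = 0} ∩
          {x : Fin 2 → ℝ | MvPolynomial.aeval x (MvPolynomial.X (1 : Fin 2) : MvPolynomial (Fin 2) ℚ) = 0})ᶜ := by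
      ext w; simp [not_and, sub_eq_zero]
    rw [he]; exact h
  have : {w : Fin 2 → ℝ | w 1 ≤ 0 ∧ ¬(w 0 = 0 ∧ w 1 = 0) ∧ ¬(w 0 = 1728 ∧ w 1 = 0)} =
      {w : Fin 2 → ℝ | w 1 ≤ 0} ∩ ({w | ¬(w 0 = 0 ∧ w 1 = 0)} ∩ {w | ¬(w 0 = 1728 ∧ w 1 = 0)}) := by
    ext w; simp
  rw [this]
  exact h1.inter (h2.inter h3)

/-- The complex point `w₀ + i w₁` of `w ∈ ℝ²` depends continuously on `w`. [folklore] -/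
theorem continuous_cx2 : Continuous fun w : Fin 2 → ℝ => ((w 0 : ℂ) + (w 1 : ℂ) * Complex.I) := by
  fun_prop

/-- **`re G` and `im G` are `ℚ`-semialgebraic on the punctured closed lower half plane** for
`G = (ω_f/dj)(f ∣ h) ∘ ψ`, `f` with rational coefficients: the graph of the continuous `re G` lies in
the Tarski–Seidenberg projection of `{P₁(u, a + ib) = 0}`, which has finite fibres (`P₁(u, ·) ≠ 0` by
primitivity), so the selection lemma `isSemialgebraicFunOn_of_continuousOn_of_finite_fibres`
(cylindrical decomposition over `ℚ`) applies. [cite: BasuPollackRoy2006, Thm. 5.6, Cor. 5.7 and Thm. 2.76] -/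
theorem isSemialgebraicFunOn_reIm_djQuot_tileInv {ψ : ℂ → ℍ}
    (hψ : ∀ u : ℂ, u.im ≤ 0 → ψ u ∈ {z : ℍ | z ∈ 𝒟 ∧ 0 ≤ z.re} ∧ kleinJ (ψ u) = u)
    (f : CuspForm (Gamma0 N) 2) (hf : HasRatCoeffs f) (h : SL(2, ℤ)) :
    IsSemialgebraicFunOn ℚ {w : Fin 2 → ℝ | w 1 ≤ 0 ∧ ¬(w 0 = 0 ∧ w 1 = 0) ∧ ¬(w 0 = 1728 ∧ w 1 = 0)}
      (fun w => (djQuot (⇑f ∣[(2 : ℤ)] h) (ψ ((w 0 : ℂ) + (w 1 : ℂ) * Complex.I))).re) ∧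
    IsSemialgebraicFunOn ℚ {w : Fin 2 → ℝ | w 1 ≤ 0 ∧ ¬(w 0 = 0 ∧ w 1 = 0) ∧ ¬(w 0 = 1728 ∧ w 1 = 0)}
      (fun w => (djQuot (⇑f ∣[(2 : ℤ)] h) (ψ ((w 0 : ℂ) + (w 1 : ℂ) * Complex.I))).im) := by
  obtain ⟨P₁, hprim, hP₁⟩ := exists_isPrimitive_evalC_djQuot_tileInv_eq_zero hψ f hf h
  have hD := isSemialgebraic_puncturedLowerHalfPlane
  set Dw := {w : Fin 2 → ℝ | w 1 ≤ 0 ∧ ¬(w 0 = 0 ∧ w 1 = 0) ∧ ¬(w 0 = 1728 ∧ w 1 = 0)} with hDw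
  have hmaps : ∀ w ∈ Dw, ((w 0 : ℂ) + (w 1 : ℂ) * Complex.I) ∈ {u : ℂ | u.im ≤ 0 ∧ u ≠ 0 ∧ u ≠ 1728} := by
    rintro w ⟨h1, h2, h3⟩
    refine ⟨by simpa using h1, fun h0 => h2 ?_, fun h0 => h3 ?_⟩
    · have := Complex.ext_iff.mp h0; simp at this; exact ⟨this.1, this.2⟩
    · have := Complex.ext_iff.mp h0; simp at this; exact ⟨this.1, this.2⟩
  have hcontG : ContinuousOn (fun w : Fin 2 → ℝ => djQuot (⇑f ∣[(2 : ℤ)] h) (ψ ((w 0 : ℂ) + (w 1 : ℂ) * Complex.I))) Dw :=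
    (continuousOn_djQuot_tileInv hψ (isCuspFunction_slash f h).mdifferentiable).comp
      continuous_cx2.continuousOn hmaps
  constructor
  · refine isSemialgebraicFunOn_of_continuousOn_of_finite_fibres
      (isSemialgebraic_setOf_exists_evalC4_re P₁) (fun x => ?_) hD
      (Complex.continuous_re.comp_continuousOn hcontG) fun x hx => ?_
    · rw [setOf_snoc2_mem_eq x fun u v a => ∃ b : ℝ,
        eval₂ (Polynomial.aeval (R := ℚ) ((u : ℂ) + (v : ℂ) * Complex.I) : ℚ[X] →+* ℂ)
          ((a : ℂ) + (b : ℂ) * Complex.I) P₁ = 0]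
      exact (finite_re_of_map_ne_zero P₁ (map_ne_zero_of_isPrimitive hprim _)).1
    · have hm := (Set.ext_iff.mp (setOf_snoc2_mem_eq x fun u v a => ∃ b : ℝ,
        eval₂ (Polynomial.aeval (R := ℚ) ((u : ℂ) + (v : ℂ) * Complex.I) : ℚ[X] →+* ℂ)
          ((a : ℂ) + (b : ℂ) * Complex.I) P₁ = 0)
        (djQuot (⇑f ∣[(2 : ℤ)] h) (ψ ((x 0 : ℂ) + (x 1 : ℂ) * Complex.I))).re).mpr
      apply hm
      refine ⟨(djQuot (⇑f ∣[(2 : ℤ)] h) (ψ ((x 0 : ℂ) + (x 1 : ℂ) * Complex.I))).im, ?_⟩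
      rw [Complex.re_add_im]
      exact hP₁ _ (hmaps x hx)
  · refine isSemialgebraicFunOn_of_continuousOn_of_finite_fibres
      (isSemialgebraic_setOf_exists_evalC4_im P₁) (fun x => ?_) hD
      (Complex.continuous_im.comp_continuousOn hcontG) fun x hx => ?_
    · rw [setOf_snoc2_mem_eq x fun u v b => ∃ a : ℝ,
        eval₂ (Polynomial.aeval (R := ℚ) ((u : ℂ) + (v : ℂ) * Complex.I) : ℚ[X] →+* ℂ)
          ((a : ℂ) + (b : ℂ) * Complex.I) P₁ = 0]
      exact (finite_re_of_map_ne_zero P₁ (map_ne_zero_of_isPrimitive hprim _)).2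
    · have hm := (Set.ext_iff.mp (setOf_snoc2_mem_eq x fun u v b => ∃ a : ℝ,
        eval₂ (Polynomial.aeval (R := ℚ) ((u : ℂ) + (v : ℂ) * Complex.I) : ℚ[X] →+* ℂ)
          ((a : ℂ) + (b : ℂ) * Complex.I) P₁ = 0)
        (djQuot (⇑f ∣[(2 : ℤ)] h) (ψ ((x 0 : ℂ) + (x 1 : ℂ) * Complex.I))).im).mpr
      apply hm
      refine ⟨(djQuot (⇑f ∣[(2 : ℤ)] h) (ψ ((x 0 : ℂ) + (x 1 : ℂ) * Complex.I))).re, ?_⟩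
      rw [Complex.re_add_im]
      exact hP₁ _ (hmaps x hx)

end Semialgebraic


end Summit.KontsevichZagierPeriods.HeckeMultiplicityOne.ManinStokes
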